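import Literature.Geometry.Kaehler.ComplexTorusTranscendentalLatticeAllDegrees
import Literature.Geometry.Kaehler.ComplexTorusIntegralHardLefschetz
import Literature.Geometry.Kaehler.ComplexTorusDivisorClassesRing
import HarnessLib

/-!
# Integral hard Lefschetz respects the transcendental lattices: `⟨t, θʲ ∧ x⟩ = ⟨θʲ ∧ t, x⟩`, `θʲ ∧ T ⊆ T`, and
# `L^{g−2p} : (Hdg^{g−p})^⊥ ⊂ H^{2p}(X, ℤ) ↪ (Hdgᵖ)^⊥ ⊂ H^{2g−2p}(X, ℤ)` is injective with finite cokernel on a polarized torus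

Layer `Literature/Geometry/Kaehler`, namespace `Literature.Geometry.Kaehler.ComplexTorus`; lane `lit-hodgefound` (Track 2 foundations
library), seat p09, generation 31, row g31-#14. THEOREMS ONLY (0 definitions); no named fact, net debt 0. The companion, for the degree-`l`
transcendental lattices `T = Hdg^{k,p}(X, ℤ)^⊥ ∩ Hˡ(X, ℤ)` of g31-#11 (written out exactly as there), of g31-#5
(`ComplexTorusIntegralHardLefschetz`: `L^{g−2p} : Hdgᵖ(X, ℤ) ↪ Hdg^{g−p}(X, ℤ)` injective with finite cokernel). For `θ = ofRealForm η`,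
`η ∈ NS(X)` (`IsNSForm Φ η`), and the cup-product pairing `⟨γ, δ⟩_e = (γ ∧ δ)(λ_{e 0}, …, λ_{e(n−1)})`:

* §1 **`⟨t, θʲ ∧ x⟩ = ⟨θʲ ∧ t, x⟩`** for forms `t ∈ Λᵃ`, `x ∈ Λˡ` and ANY `2`-form `θ` (associativity and evenness of `θʲ`: the tree's discharged
  `ContinuousAlternatingMap.WedgeAssoc_holds` and `wedge_comm_of_even_left`; Lange Lemma 5.4.3 (a)).
* §2 **`θʲ ∧ T(2j + a, j + p′; l) ⊆ T(a, p′; 2j + l)`**: if `x ∈ Hˡ(X, ℤ)` annihilates `Hdg^{2j+a, j+p′}(X, ℤ)` then `θʲ ∧ x` annihilates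
  `Hdg^{a,p′}(X, ℤ)` (`⟨t, θʲ x⟩ = ⟨θʲ t, x⟩ = 0` since `θʲ ∧ Hdg^{a,p′}(X, ℤ) ⊆ Hdg^{2j+a, j+p′}(X, ℤ)`, g31-#5) — as an explicit `ℤ`-linear map.
* §3 `2p + j = g`, `η` non-degenerate: **`L^{j} : (Hdg^{j+p})^⊥ ∩ H^{2p}(X, ℤ) → (Hdgᵖ)^⊥ ∩ H^{2j+2p}(X, ℤ)` is injective** (hard Lefschetz
  on `H^{2p}`, the tree's `wedgePow_wedge_injective`) **with finite cokernel** (both lattices have rank `C(2g, 2p) − rk Hdgᵖ(X, ℤ)`: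
  g31-#11's rank formula, g31-#5's `rk Hdgᵖ = rk Hdg^{g−p}`, `C(2g, 2p) = C(2g, 2g−2p)`), hence one exponent `n ≥ 1` with
  `n · T_{2g−2p} ⊆ θʲ ∧ T_{2p}`; `IsRiemannForm` corollaries.

## References

* [cite: Lange2023AbelianVarietiesComplex, §5.4.1 Lemma 5.4.3 (a); §7.3.2 (1) (hard Lefschetz `L^{g−k} : Hᵏ ⥲ H^{2g−k}`); §6.2.4 (p. 310); §7.2.2]
* [cite: VoisinHodgeI2002, §6.2.3 Lemma 6.20 and §7.1.2 (PDF p. 134 L31: the Lefschetz isomorphism is defined over `ℤ` but NOT an isomorphism over `ℤ`)]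
* [cite: Huybrechts2016K3, Ch. 3 §2.2–2.3 (PDF pp. 58–59)]
-/

noncomputable section

open Module Function

namespace Literature.Geometry.Kaehler.ComplexTorus

section LefschetzTranscendental

variable {ι : Type*} [Fintype ι] [DecidableEq ι] {E : Type*} [NormedAddCommGroup E] [NormedSpace ℂ E]
  (Φ : (ι → ℝ) ≃L[ℝ] E) {n : ℕ} (e : Fin n ≃ ι)

/-! ## §1 `⟨t, θʲ ∧ x⟩ = ⟨θʲ ∧ t, x⟩` -/

omit [Fintype ι] in
/-- **`⟨t, θʲ ∧ x⟩_e = ⟨θʲ ∧ t, x⟩_e`**: a power of a `2`-form moves across the cup-product pairing (`t ∧ (θʲ ∧ x) = (t ∧ θʲ) ∧ x =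
(θʲ ∧ t) ∧ x` up to the reindexing casts, which do not change the lattice tuple the pairing evaluates on).
[cite: Lange2023AbelianVarietiesComplex, §5.4.1 Lemma 5.4.3 (a) and §6.2.4 (p. 310)] -/
theorem poincarePairing_wedgePow_wedge_right (θ : E [⋀^Fin 2]→L[ℝ] ℂ) (j : ℕ) {a l : ℕ} (h₁ : a + (2 * j + l) = n)
    (h₂ : 2 * j + a + l = n) (t : E [⋀^Fin a]→L[ℝ] ℂ) (x : E [⋀^Fin l]→L[ℝ] ℂ) :
    poincarePairing Φ e h₁ t ((wedgePow θ j).wedge x) = poincarePairing Φ e h₂ ((wedgePow θ j).wedge t) x := by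
  simp only [poincarePairing, LinearMap.mk₂_apply]
  have hA := ContinuousAlternatingMap.WedgeAssoc_holds ℝ E ℂ t (wedgePow θ j) x
  rw [wedge_comm_of_even_left (wedgePow θ j) t, Literature.LinearAlgebra.Alternating.domDomCongr_finCongr_wedge] at hA
  have hev := congrArg (fun φ : E [⋀^Fin (a + 2 * j + l)]→L[ℝ] ℂ ↦ φ (orderedBasis Φ e ∘ Fin.cast (by omega : a + 2 * j + l = n))) hA
  simp only [ContinuousAlternatingMap.domDomCongr_apply] at hev
  convert hev.symm using 2 <;> exact funext fun i ↦ rfl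

/-! ## §2 `θʲ ∧ T ⊆ T` -/

omit [Fintype ι] in
/-- **`θʲ ∧ T(2j + a, j + p′; l) ⊆ T(a, p′; 2j + l)`**: for `η ∈ NS(X)` and `x ∈ Hˡ(X, ℤ)` annihilating `Hdg^{2j+a, j+p′}(X, ℤ)`, the class
`θʲ ∧ x ∈ H^{2j+l}(X, ℤ)` annihilates `Hdg^{a,p′}(X, ℤ)`: `⟨t, θʲ ∧ x⟩ = ⟨θʲ ∧ t, x⟩ = 0` because `θʲ ∧ t ∈ Hdg^{2j+a, j+p′}(X, ℤ)` (g31-#5's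
`wedgePow_wedge_mem_integralHodgeClassesIn`). [cite: Lange2023AbelianVarietiesComplex, §7.3.1 and §7.3.2 (1)] [cite: Huybrechts2016K3, Ch. 3 §2.2 (PDF p. 58)] -/
theorem wedgePow_wedge_mem_integralHodgeAnnihilator {η : E [⋀^Fin 2]→L[ℝ] ℝ} (hη : IsNSForm Φ η) (j : ℕ) {a l p' : ℕ}
    (h : 2 * j + a + l = n) (h' : a + (2 * j + l) = n) {x : E [⋀^Fin l]→L[ℝ] ℂ}
    (hx : x ∈ integralForms Φ l ⊓ ⨅ s : integralHodgeClassesIn Φ (2 * j + a) (j + p'),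
        (LinearMap.ker (poincarePairing Φ e h (s : E [⋀^Fin (2 * j + a)]→L[ℝ] ℂ))).toAddSubgroup) :
    (wedgePow (ofRealForm η) j).wedge x ∈ integralForms Φ (2 * j + l) ⊓ ⨅ s : integralHodgeClassesIn Φ a p',
        (LinearMap.ker (poincarePairing Φ e h' (s : E [⋀^Fin a]→L[ℝ] ℂ))).toAddSubgroup := by
  rw [mem_integralHodgeAnnihilator_iff] at hx ⊢
  refine ⟨wedgePow_wedge_mem_integralForms Φ hη j hx.1, fun t ht ↦ ?_⟩
  rw [poincarePairing_wedgePow_wedge_right Φ e (ofRealForm η) j h' h t x]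
  exact hx.2 _ (wedgePow_wedge_mem_integralHodgeClassesIn Φ hη j ht)

omit [Fintype ι] in
/-- **`L^j = θʲ ∧ ·` as a `ℤ`-linear map `T(2j + a, j + p′; l) → T(a, p′; 2j + l)`** between transcendental lattices.
[cite: Lange2023AbelianVarietiesComplex, §7.3.2 (1)] -/
theorem exists_intLinearMap_integralHodgeAnnihilator_wedgePow_wedge {η : E [⋀^Fin 2]→L[ℝ] ℝ} (hη : IsNSForm Φ η) (j : ℕ)
    {a l p' : ℕ} (h : 2 * j + a + l = n) (h' : a + (2 * j + l) = n) :
    ∃ L : ↥(integralForms Φ l ⊓ ⨅ s : integralHodgeClassesIn Φ (2 * j + a) (j + p'),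
          (LinearMap.ker (poincarePairing Φ e h (s : E [⋀^Fin (2 * j + a)]→L[ℝ] ℂ))).toAddSubgroup) →ₗ[ℤ]
        ↥(integralForms Φ (2 * j + l) ⊓ ⨅ s : integralHodgeClassesIn Φ a p',
          (LinearMap.ker (poincarePairing Φ e h' (s : E [⋀^Fin a]→L[ℝ] ℂ))).toAddSubgroup),
      ∀ x, (L x : E [⋀^Fin (2 * j + l)]→L[ℝ] ℂ) = (wedgePow (ofRealForm η) j).wedge (x : E [⋀^Fin l]→L[ℝ] ℂ) :=
  ⟨(AddMonoidHom.mk' (fun x ↦ ⟨(wedgePow (ofRealForm η) j).wedge (x : E [⋀^Fin l]→L[ℝ] ℂ),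
      wedgePow_wedge_mem_integralHodgeAnnihilator Φ e hη j h h' x.2⟩)
      fun _ _ ↦ Subtype.ext (ContinuousAlternatingMap.wedge_add_right _ _ _)).toIntLinearMap, fun _ ↦ rfl⟩

/-! ## §3 `2p + j = g`: `L^j : (Hdg^{j+p})^⊥ ∩ H^{2p}(X, ℤ) ↪ (Hdgᵖ)^⊥ ∩ H^{2j+2p}(X, ℤ)` is injective with finite cokernel -/

omit [DecidableEq ι] in
/-- The degree-`l` transcendental lattice is finitely generated and free (a subgroup of the lattice `Hˡ(X, ℤ)`); recorded with the rank-`0`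
bookkeeping used below. [cite: Lange2023AbelianVarietiesComplex, §1.1.3 Exercise 1.1.6 (8)] -/
private theorem moduleFinite_and_free_of_le {m : ℕ} (T : AddSubgroup (E [⋀^Fin m]→L[ℝ] ℂ)) (hT : T ≤ integralForms Φ m) :
    Module.Finite ℤ T ∧ Module.Free ℤ T := by
  haveI : Module.Finite ℤ (integralForms Φ m) := finite_integralForms Φ m
  haveI : Module.Free ℤ (integralForms Φ m) := free_integralForms Φ m
  let i := (AddSubgroup.inclusion hT).toIntLinearMap
  have hi : Injective i := AddSubgroup.inclusion_injective hT
  haveI : Module.Finite ℤ T := Module.Finite.of_injective i hi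
  haveI : Module.IsTorsionFree ℤ T := hi.moduleIsTorsionFree i (map_smul i)
  exact ⟨inferInstance, inferInstance⟩

/-- **Equal ranks: `rk (Hdg^{j+p})^⊥_{H^{2p}} = rk (Hdgᵖ)^⊥_{H^{2j+2p}}`** on a polarized torus with `2p + j = g` (g31-#11's
`rk T = C(2g, l) − rk Hdg`, g31-#5's `rk Hdgᵖ(X, ℤ) = rk Hdg^{g−p}(X, ℤ)`, and `C(2g, 2p) = C(2g, 2g − 2p)`).
[cite: Lange2023AbelianVarietiesComplex, §7.3.2 (1) and §1.1.3 Exercise 1.1.6 (8)] -/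
theorem finrank_integralHodgeAnnihilator_eq_of_hardLefschetz [FiniteDimensional ℂ E] {η : E [⋀^Fin 2]→L[ℝ] ℝ} (hηNS : IsNSForm Φ η)
    (hη : ∀ v : E, v ≠ 0 → ∃ w : E, η ![v, w] ≠ 0) {p j : ℕ} (hpj : 2 * p + j = finrank ℂ E)
    (h : 2 * j + 2 * p + 2 * p = n) (h' : 2 * p + (2 * j + 2 * p) = n) :
    finrank ℤ ↥(integralForms Φ (2 * p) ⊓ ⨅ s : integralHodgeClassesIn Φ (2 * j + 2 * p) (j + p),
        (LinearMap.ker (poincarePairing Φ e h (s : E [⋀^Fin (2 * j + 2 * p)]→L[ℝ] ℂ))).toAddSubgroup) =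
      finrank ℤ ↥(integralForms Φ (2 * j + 2 * p) ⊓ ⨅ s : integralHodgeClassesIn Φ (2 * p) p,
        (LinearMap.ker (poincarePairing Φ e h' (s : E [⋀^Fin (2 * p)]→L[ℝ] ℂ))).toAddSubgroup) := by
  have hcard : Fintype.card ι = n := by rw [← Fintype.card_congr e, Fintype.card_fin]
  have h2 := card_eq_two_mul_finrank Φ
  have hs := finrank_integralHodgeAnnihilator_add_finrank_integralHodgeClassesIn Φ e h (j + p)
  have ht := finrank_integralHodgeAnnihilator_add_finrank_integralHodgeClassesIn Φ e h' p
  have hH : finrank ℤ (integralHodgeClassesIn Φ (2 * j + 2 * p) (j + p)) = finrank ℤ (integralHodgeClassesIn Φ (2 * p) p) := by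
    rw [finrank_integralHodgeClassesIn_congr Φ (show 2 * j + 2 * p = 2 * (j + p) by ring) (j + p)]
    exact (finrank_integralHodgeClasses_eq_of_add_eq Φ hηNS hη (p := p) (q := j + p) (by omega)).symm
  have hC : (Fintype.card ι).choose (2 * p) = (Fintype.card ι).choose (2 * j + 2 * p) := by
    rw [hcard, ← h', Nat.choose_symm_add]
  omega

/-- **`L^j : (Hdg^{j+p})^⊥ ∩ H^{2p}(X, ℤ) → (Hdgᵖ)^⊥ ∩ H^{2j+2p}(X, ℤ)` is injective with FINITE cokernel** (`2p + j = g`, `η ∈ NS(X)`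
non-degenerate): injective by hard Lefschetz on `H^{2p}` (the tree's `wedgePow_wedge_injective`), finite cokernel because source and target
have the same rank (`finrank_integralHodgeAnnihilator_eq_of_hardLefschetz`, Mathlib's `Submodule.finiteQuotientOfFreeOfRankEq`) — the
transcendental companion of g31-#5's `L^j : Hdgᵖ(X, ℤ) ↪ Hdg^{j+p}(X, ℤ)`; over `ℤ` the cokernel need not vanish (Voisin §7.1.2).
[cite: Lange2023AbelianVarietiesComplex, §7.3.2 (1)] [cite: VoisinHodgeI2002, §6.2.3 Lemma 6.20 and §7.1.2 (PDF p. 134 L31)] -/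
theorem exists_intLinearMap_integralHodgeAnnihilator_wedgePow_wedge_injective_finite [FiniteDimensional ℂ E] {η : E [⋀^Fin 2]→L[ℝ] ℝ}
    (hηNS : IsNSForm Φ η) (hη : ∀ v : E, v ≠ 0 → ∃ w : E, η ![v, w] ≠ 0) {p j : ℕ} (hpj : 2 * p + j = finrank ℂ E)
    (h : 2 * j + 2 * p + 2 * p = n) (h' : 2 * p + (2 * j + 2 * p) = n) :
    ∃ L : ↥(integralForms Φ (2 * p) ⊓ ⨅ s : integralHodgeClassesIn Φ (2 * j + 2 * p) (j + p),
          (LinearMap.ker (poincarePairing Φ e h (s : E [⋀^Fin (2 * j + 2 * p)]→L[ℝ] ℂ))).toAddSubgroup) →ₗ[ℤ]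
        ↥(integralForms Φ (2 * j + 2 * p) ⊓ ⨅ s : integralHodgeClassesIn Φ (2 * p) p,
          (LinearMap.ker (poincarePairing Φ e h' (s : E [⋀^Fin (2 * p)]→L[ℝ] ℂ))).toAddSubgroup),
      (∀ x, (L x : E [⋀^Fin (2 * j + 2 * p)]→L[ℝ] ℂ) = (wedgePow (ofRealForm η) j).wedge (x : E [⋀^Fin (2 * p)]→L[ℝ] ℂ)) ∧
        Injective L ∧
        Finite (↥(integralForms Φ (2 * j + 2 * p) ⊓ ⨅ s : integralHodgeClassesIn Φ (2 * p) p,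
          (LinearMap.ker (poincarePairing Φ e h' (s : E [⋀^Fin (2 * p)]→L[ℝ] ℂ))).toAddSubgroup) ⧸ LinearMap.range L) := by
  obtain ⟨L, hL⟩ := exists_intLinearMap_integralHodgeAnnihilator_wedgePow_wedge Φ e hηNS j (a := 2 * p) (l := 2 * p) (p' := p) h h'
  have hinj : Injective L := fun x y hxy ↦ by
    have h1 := congrArg (fun z : ↥(integralForms Φ (2 * j + 2 * p) ⊓ ⨅ s : integralHodgeClassesIn Φ (2 * p) p,
      (LinearMap.ker (poincarePairing Φ e h' (s : E [⋀^Fin (2 * p)]→L[ℝ] ℂ))).toAddSubgroup) ↦ (z : E [⋀^Fin (2 * j + 2 * p)]→L[ℝ] ℂ)) hxy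
    simp only [hL] at h1
    exact Subtype.ext (wedgePow_wedge_injective hη hpj h1)
  obtain ⟨hfin, hfree⟩ := moduleFinite_and_free_of_le Φ (integralForms Φ (2 * j + 2 * p) ⊓ ⨅ s : integralHodgeClassesIn Φ (2 * p) p,
      (LinearMap.ker (poincarePairing Φ e h' (s : E [⋀^Fin (2 * p)]→L[ℝ] ℂ))).toAddSubgroup) inf_le_left
  have hrk : finrank ℤ (LinearMap.range L) = finrank ℤ ↥(integralForms Φ (2 * j + 2 * p) ⊓ ⨅ s : integralHodgeClassesIn Φ (2 * p) p,
      (LinearMap.ker (poincarePairing Φ e h' (s : E [⋀^Fin (2 * p)]→L[ℝ] ℂ))).toAddSubgroup) := by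
    rw [← (LinearEquiv.ofInjective L hinj).finrank_eq, finrank_integralHodgeAnnihilator_eq_of_hardLefschetz Φ e hηNS hη hpj h h']
  exact ⟨L, hL, hinj, Submodule.finiteQuotientOfFreeOfRankEq _ hrk⟩

/-- **One exponent kills the cokernel: `n · (Hdgᵖ)^⊥_{H^{2j+2p}(X, ℤ)} ⊆ θʲ ∧ (Hdg^{j+p})^⊥_{H^{2p}(X, ℤ)}`** for some `n ≥ 1` (`2p + j = g`).
[cite: Lange2023AbelianVarietiesComplex, §7.3.2 (1) and §1.1.3 Exercise 1.1.6 (8)] [cite: VoisinHodgeI2002, §7.1.2 (PDF p. 134 L31)] -/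
theorem exists_pos_forall_integralHodgeAnnihilator_nsmul_eq_wedgePow_wedge [FiniteDimensional ℂ E] {η : E [⋀^Fin 2]→L[ℝ] ℝ}
    (hηNS : IsNSForm Φ η) (hη : ∀ v : E, v ≠ 0 → ∃ w : E, η ![v, w] ≠ 0) {p j : ℕ} (hpj : 2 * p + j = finrank ℂ E)
    (h : 2 * j + 2 * p + 2 * p = n) (h' : 2 * p + (2 * j + 2 * p) = n) :
    ∃ N : ℕ, 0 < N ∧ ∀ y ∈ integralForms Φ (2 * j + 2 * p) ⊓ ⨅ s : integralHodgeClassesIn Φ (2 * p) p,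
          (LinearMap.ker (poincarePairing Φ e h' (s : E [⋀^Fin (2 * p)]→L[ℝ] ℂ))).toAddSubgroup,
      ∃ x ∈ integralForms Φ (2 * p) ⊓ ⨅ s : integralHodgeClassesIn Φ (2 * j + 2 * p) (j + p),
          (LinearMap.ker (poincarePairing Φ e h (s : E [⋀^Fin (2 * j + 2 * p)]→L[ℝ] ℂ))).toAddSubgroup,
        (wedgePow (ofRealForm η) j).wedge x = N • y := by
  obtain ⟨L, hL, -, hfin⟩ := exists_intLinearMap_integralHodgeAnnihilator_wedgePow_wedge_injective_finite Φ e hηNS hη hpj h h'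
  haveI : Finite (↥(integralForms Φ (2 * j + 2 * p) ⊓ ⨅ s : integralHodgeClassesIn Φ (2 * p) p,
      (LinearMap.ker (poincarePairing Φ e h' (s : E [⋀^Fin (2 * p)]→L[ℝ] ℂ))).toAddSubgroup) ⧸ (LinearMap.range L).toAddSubgroup) := hfin
  refine ⟨(LinearMap.range L).toAddSubgroup.index, Nat.pos_of_ne_zero AddSubgroup.index_ne_zero_of_finite, fun y hy ↦ ?_⟩
  have hmem : (LinearMap.range L).toAddSubgroup.index • (⟨y, hy⟩ : ↥(integralForms Φ (2 * j + 2 * p) ⊓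
      ⨅ s : integralHodgeClassesIn Φ (2 * p) p, (LinearMap.ker (poincarePairing Φ e h' (s : E [⋀^Fin (2 * p)]→L[ℝ] ℂ))).toAddSubgroup)) ∈
      (LinearMap.range L).toAddSubgroup := AddSubgroup.nsmul_index_mem _ _
  obtain ⟨x, hx⟩ := (Submodule.mem_toAddSubgroup _).1 hmem
  refine ⟨x, x.2, ?_⟩
  have h1 := congrArg (fun z : ↥(integralForms Φ (2 * j + 2 * p) ⊓ ⨅ s : integralHodgeClassesIn Φ (2 * p) p,
    (LinearMap.ker (poincarePairing Φ e h' (s : E [⋀^Fin (2 * p)]→L[ℝ] ℂ))).toAddSubgroup) ↦ (z : E [⋀^Fin (2 * j + 2 * p)]→L[ℝ] ℂ)) hx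
  simpa only [hL, AddSubgroupClass.coe_nsmul] using h1

/-- `IsRiemannForm` version of the finite-cokernel statement (a polarization is a non-degenerate NS form).
[cite: Lange2023AbelianVarietiesComplex, §7.3.2 (1) and §4.1] -/
theorem IsRiemannForm.exists_intLinearMap_integralHodgeAnnihilator_wedgePow_wedge_injective_finite [FiniteDimensional ℂ E]
    {η : E [⋀^Fin 2]→L[ℝ] ℝ} (hη : IsRiemannForm Φ η) {p j : ℕ} (hpj : 2 * p + j = finrank ℂ E)
    (h : 2 * j + 2 * p + 2 * p = n) (h' : 2 * p + (2 * j + 2 * p) = n) :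
    ∃ L : ↥(integralForms Φ (2 * p) ⊓ ⨅ s : integralHodgeClassesIn Φ (2 * j + 2 * p) (j + p),
          (LinearMap.ker (poincarePairing Φ e h (s : E [⋀^Fin (2 * j + 2 * p)]→L[ℝ] ℂ))).toAddSubgroup) →ₗ[ℤ]
        ↥(integralForms Φ (2 * j + 2 * p) ⊓ ⨅ s : integralHodgeClassesIn Φ (2 * p) p,
          (LinearMap.ker (poincarePairing Φ e h' (s : E [⋀^Fin (2 * p)]→L[ℝ] ℂ))).toAddSubgroup),
      (∀ x, (L x : E [⋀^Fin (2 * j + 2 * p)]→L[ℝ] ℂ) = (wedgePow (ofRealForm η) j).wedge (x : E [⋀^Fin (2 * p)]→L[ℝ] ℂ)) ∧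
        Injective L ∧
        Finite (↥(integralForms Φ (2 * j + 2 * p) ⊓ ⨅ s : integralHodgeClassesIn Φ (2 * p) p,
          (LinearMap.ker (poincarePairing Φ e h' (s : E [⋀^Fin (2 * p)]→L[ℝ] ℂ))).toAddSubgroup) ⧸ LinearMap.range L) :=
  ComplexTorus.exists_intLinearMap_integralHodgeAnnihilator_wedgePow_wedge_injective_finite Φ e hη.isNSForm
    (IsRiemannForm.exists_apply_ne_zero Φ hη) hpj h h'

end LefschetzTranscendental

end Literature.Geometry.Kaehler.ComplexTorus
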